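import Summits.QuantumFields.BalabanUV.T4Continuum.Support.NE3ExactLineSumsTower
import Summits.QuantumFields.BalabanUV.T4Continuum.Support.NE3CombGauge
import Summits.QuantumFields.BalabanUV.T4Continuum.Support.NE3FramePotGauge
import Summits.QuantumFields.BalabanUV.T4Continuum.Support.AveragingDeficitTransportCalc
import HarnessLib
/-!
# T⁴ programme, node NE3, route H♮ (ρ-g22-2) · junction J-ne3r2-g8-1, file 1∕3 — COVARIANCE OF THE TRANSPORTED BLOCK MEANS, THEIR
# FLAT SIDE, AND THE ONE-LEVEL NEAR-IDENTITY ESTIMATES (the tools of the nested-vs-single-scale block-mean bridge)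

Row NE3-R2 (unit `b2b-balaban-t4-ne3r2-p1`, gen 8; disprover duty on the NE3 owner's route H♮, design memo
`HOME/t4/b2b-balaban-t4-ne3-p1/g22/D-ne3p1-g22-1.md`; junction J-ne3r2-g8-1 HOME/CLAIMS.log l.18448, rulings l.18532 ∕ ρ-g23-1 l.18554).
WHY.  Step S3 of route H♮ forces the gauge potential of the co-closed chain to be the NESTED transported block mean
(`QstrIter L k W (gaugeDir W ζ′) = gaugeDir (cavgIter L k W) (bmeanIterW L k W ζ′) + DefIter`, leaf-04's K3 file 2
`NE3ExactLineSumsTower.QstrIter_gaugeDir_eq`), whose transports run through the averaging TOWER `W, cavg L W, …`, while S4's Landau-kill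
error is closed by the covariant block Poincaré inequality K2 (leaf-04, `NE3CovariantBlockPoincare`), typed for the SINGLE-SCALE pair
(`btree M W z`, `bmeanW M W`), `M = L^k` (K4-c roots with the same `btree`, ρ-g23-1: J3 ≡ 0).  The K6 assembly needs exactly ONE comparison:
`bmeanW (L^k) W ξ` versus `bmeanIterW L k W ξ`, with a k-FREE constant.

THIS FILE (all [folklore]; 0 `def`, 0 sorry) — the tools; file 2 `NE3NestedBlockMeanBridge` runs the k-free induction in the comb gauge,
file 3 `NE3TowerBondVsSegment` is the companion (J4) `cavgIter` vs the straight segment: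
§1 COVARIANCE: `bmeanW_gaugeAct` (`bmeanW L (W^u) (Ad_u μ) z = Ad_{u(L•z)} bmeanW L W μ z`, any `u`, `W` — (8) along tree
   contours), `cavg_gaugeAct` ((45): `cavg L (W^u) = (cavg L W)^{u∘(L•)}` in the standard small-field class, the tree's `bavg_gaugeAct` +
   `loopBound_of_smallField`), `bmeanIterW_gaugeAct` (through the tower, `step_small`).
§2 FLAT SIDE: `bmeanW_one = bmean`, `cavg_one`, `bmeanIterW_one = (bmean L)^[j]`, `bmeanW_eq_bmean_comb`
   (`bmeanW M W ξ z = bmean M (Ad_{btree M W z ·} ξ) z` — the single-scale mean is the FLAT mean of the comb-dressed field).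
§3 BOX BOOKKEEPING AND ONE LEVEL: `bondsOf_treeWord_box` (for `v ≥ 0` every bond of `Γ_{x,x+v}` has BOTH endpoints in `[x, x+v]`, all
   coordinates — strengthens `AveragingDeficitTransportCalc.bondsOf_treeWord_lt`), `norm_hol_treeWord_sub_one_le` ∕ `norm_hol_seg_sub_one_le`
   (near-identity box `[lo, hi]` ⇒ `≤ |v|₁·b` ∕ `k·b`, on `norm_hol_sub_one_le_of_bonds`), `comb_nearOne` (the comb gauge `W^{btree M W z}`
   is within `(d−1)(M−1)a` of `1` on the block, `NE3CombGauge.norm_comb_sub_one_le_single`), `norm_bmeanW_le_mean` (Jensen),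
   **`norm_bmeanW_sub_bmean_le`** (ONE LEVEL: `‖bmeanW L W μ y − bmean L μ y‖ ≤ 2dLb·Σ_r L^{−d}‖μ(L•y+r)‖`), `norm_cavg_sub_bseg_le`
   (`‖V̄(c) − U(Γ_c)‖ ≤ 4·loopRad`, unframed `AveragingDeficitBlockDensity.norm_cavg_inv_bseg_sub_one_le`), **`norm_cavg_sub_one_le`**
   (`‖cavg L W y ν − 1‖ ≤ L·b + 4·loopRad` on the coarse box).

HONEST FRAMING.  Bookkeeping kinematics of OUR transported block means at a background in the multi-level small-field class; nothing
about Bałaban's minimisers; (P♮)_W, (ML_w) at `W ≠ 1`, T-E_w and NE3 are NOT proved here; spine PROVED 0∕9; finite T⁴ rung (B)+1 —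
NOT infinite volume, NOT mass gap, NOT BetaPertH, NOT Clay.  ABSOLUTE RULE kept: no printed sentence is a hypothesis (context only:
[Balaban1985Averaging] (8) p. 18, (42)–(45) pp. 23–25).  PLACEMENT: `Summits/QuantumFields/BalabanUV/`; moves nothing.
HONEST DEPENDENCY: continuum YM on T⁴ ⇐ BetaPertH ∧ nine spine estimates (0/9 proved); BetaPertH ⇐ (D1) ∧ (D4) ∧ CAP+tail;
G-an2-4 gates asym, D1 and NE2/3/4.
-/

set_option autoImplicit false

open scoped BigOperators Matrix.Norms.L2Operator
open Finset

namespace Summit.QuantumFields.BalabanUV.T4Continuum.NE3NestedBlockMeanCovariance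

open Literature.MathematicalPhysics.QuantumFieldTheory.Balaban1983to89
open B7Prop1Explicit B7Prop2Explicit
open T4AveragingDeficitWall (IsUnitaryCfg SmallField Ad hol_flat bavg_flat)
open T4AveragingDeficitNonAbelian (Ad_mul Ad_sub)
open AveragingDeficitTransport (norm_Ad_of_unitary mem_U1_of_unitary)
open AveragingDeficitNearIdentity (Ad_one norm_Ad_sub_le norm_hol_sub_one_le_of_bonds Ad_sum Ad_real_smul)
open AveragingDeficitChartCalculus (cavg)
open AveragingDeficitTwoLevelPrep (prop1Radius)
open AveragingDeficitMultiLevelPrep (cavgIter LevelSmall prop1Radius_nonneg)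
open AveragingDeficitBlockDensity (btree bseg btree_mem norm_cavg_inv_bseg_sub_one_le cavg_mem)
open AveragingDeficitLocality (bondsOf)
open AveragingDeficitTransportCalc (bondsOf_append mem_bondsOf_seg_iff)
open NE3TangentCovariantTower (step_small cavgIter_succ)
open NE3CovariantBlockMean (bmeanW bmeanIterW bmeanIterW_succ bmeanIterW_zero boxVec_bounds)
open NE3GaugeDirFrames (Ad_Ad_inv)
open NE3CombGauge (btree_corner norm_comb_sub_one_le_single isUnitaryCfg_comb smallField_comb)
open NE3FramePotGauge (bmean iterate_bmean_apply)
open NE3ExactLineSumsTower (sq_mul_loopRad_le DSum DSum_succ DSum_le_top)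
open NE3ExactLineSums (blockMean_norm_sq_le)
open NE3BlockLineAverage (sum_univ_boxVec sum_periodBox_blocks)
open SpreadLift (loopRad loopRad_le loopBound_of_smallField)
open T4AveragingDeficitWallBoundary (periodBox mem_periodBox)

noncomputable section

variable {d : ℕ} {n : Type*} [Fintype n] [DecidableEq n]

/-! ## §1 Gauge covariance of the transported block means -/

/-- **COVARIANCE OF THE TRANSPORTED BLOCK MEAN**: `bmeanW L (W^u) (Ad_u μ) z = Ad_{u(L•z)} (bmeanW L W μ z)` — every transport
`W^u(Γ_{L•z,x}) = u(L•z) W(Γ) u(x)⁻¹` ((8) along a contour) eats the dressing of `μ(x)`; any `u`, any `W`, no smallness.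
[cite: Balaban1985Averaging, (8) p.18, (45) p.24] -/
theorem bmeanW_gaugeAct (L : ℕ) (u : Site d → (Matrix n n ℂ)ˣ) (W : Site d → Fin d → (Matrix n n ℂ)ˣ)
    (mu : Site d → Matrix n n ℂ) (z : Site d) :
    bmeanW L (gaugeAct u W) (fun x => Ad (u x) (mu x)) z = Ad (u ((L : ℤ) • z)) (bmeanW L W mu z) := by
  unfold bmeanW
  rw [Ad_sum]
  refine Finset.sum_congr rfl fun r _ => ?_
  rw [Ad_real_smul, hol_gaugeAct, disp_treeWord, ← Ad_mul, inv_mul_cancel_right, Ad_mul]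

/-- **COVARIANCE OF THE AVERAGE READ ON THE COARSE LATTICE** ((45) p. 24, in the loop-analyticity domain supplied by the standard
small-field class): `cavg L (W^u) = (cavg L W)^{u ∘ (L•)}`. [cite: Balaban1985Averaging, (45) p.24] -/
theorem cavg_gaugeAct [Nonempty n] {L : ℕ} (hL : 1 ≤ L) {W : Site d → Fin d → (Matrix n n ℂ)ˣ} (hWu : IsUnitaryCfg W)
    {a : ℝ} (ha : 0 ≤ a) (h512 : 512 * (d + 1) * (d + 4) * (L : ℝ) ^ 2 * a ≤ 1) (hWa : SmallField W a)
    {u : Site d → (Matrix n n ℂ)ˣ} (hu : ∀ x, u x ∈ unitaryUnits (Matrix n n ℂ)) :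
    cavg L (gaugeAct u W) = gaugeAct (fun w => u ((L : ℤ) • w)) (cavg L W) := by
  funext y κ
  have hloop : ∀ r : Fin d → Fin L, ‖((Wcx L W ((L : ℤ) • y) κ (boxVec L r) : (Matrix n n ℂ)ˣ) : Matrix n n ℂ) - 1‖ < 1 :=
    fun r => ((loopBound_of_smallField hL hWu ha h512 hWa y κ) r).trans_lt (by linarith [loopRad_le (d := d) h512])
  show bavg L (gaugeAct u W) ((L : ℤ) • y) κ = u ((L : ℤ) • y) * bavg L W ((L : ℤ) • y) κ * (u ((L : ℤ) • (y + e κ)))⁻¹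
  rw [bavg_gaugeAct L (fun x => mem_U1_of_unitary (hu x)) W _ κ hloop, smul_add]

/-- **COVARIANCE OF THE NESTED MEAN THROUGH THE TOWER** (multi-level small-field class: `IsUnitaryCfg W`, `0 ≤ x`, `LevelSmall d L j x`,
`SmallField W x`; unitary `u`): `bmeanIterW L (j+1) (W^u) (Ad_u μ) z = Ad_{u(L^{j+1}•z)} (bmeanIterW L (j+1) W μ z)` — the class is
gauge invariant and persists under averaging (`step_small`), and each level is `bmeanW_gaugeAct` ∘ `cavg_gaugeAct`. [folklore] -/
theorem bmeanIterW_gaugeAct [Nonempty n] {L : ℕ} (hL : 1 ≤ L) (j : ℕ) :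
    ∀ {W : Site d → Fin d → (Matrix n n ℂ)ˣ} {x : ℝ}, IsUnitaryCfg W → 0 ≤ x → LevelSmall d L j x → SmallField W x →
    ∀ {u : Site d → (Matrix n n ℂ)ˣ}, (∀ y, u y ∈ unitaryUnits (Matrix n n ℂ)) →
    ∀ (mu : Site d → Matrix n n ℂ) (z : Site d),
      bmeanIterW L (j + 1) (gaugeAct u W) (fun y => Ad (u y) (mu y)) z
        = Ad (u (((L ^ (j + 1) : ℕ) : ℤ) • z)) (bmeanIterW L (j + 1) W mu z) := by
  induction j with
  | zero =>
      intro W x _ _ _ _ u _ mu z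
      rw [bmeanIterW_succ, bmeanIterW_zero, bmeanIterW_succ, bmeanIterW_zero, bmeanW_gaugeAct]
      simp
  | succ j ih =>
      intro W x hWu hx hsm hWx u hu mu z
      obtain ⟨h512, hW₁u, hr0, hW₁x⟩ := step_small hL hWu hx hsm.1 hWx
      rw [bmeanIterW_succ, bmeanIterW_succ L (j + 1) W, cavg_gaugeAct hL hWu hx h512 hWx hu]
      have hfun : bmeanW L (gaugeAct u W) (fun y => Ad (u y) (mu y)) = fun w => Ad (u ((L : ℤ) • w)) (bmeanW L W mu w) :=
        funext fun w => bmeanW_gaugeAct L u W mu w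
      rw [hfun, ih hW₁u hr0 hsm.2 hW₁x (fun y => hu _) (bmeanW L W mu) z, smul_smul]
      congr 2
      push_cast
      ring

/-! ## §2 The flat side: at `W = 1` the transported means are the flat block means, and they nest -/

/-- At the flat background the transported block mean is NE3-R2's flat `bmean`. [folklore] -/
theorem bmeanW_one (L : ℕ) (mu : Site d → Matrix n n ℂ) : bmeanW L (1 : Site d → Fin d → (Matrix n n ℂ)ˣ) mu = bmean L mu := by
  funext z
  unfold bmeanW bmean
  refine Finset.sum_congr rfl fun r _ => ?_
  rw [show (1 : Site d → Fin d → (Matrix n n ℂ)ˣ) = fun _ _ => 1 from rfl, hol_flat, Ad_one]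

/-- The average of the flat background is flat: `cavg L 1 = 1`. [folklore] -/
theorem cavg_one (L : ℕ) : cavg L (1 : Site d → Fin d → (Matrix n n ℂ)ˣ) = 1 := by
  funext y κ
  show bavg L (fun (_ : Site d) (_ : Fin d) => (1 : (Matrix n n ℂ)ˣ)) ((L : ℤ) • y) κ = 1
  rw [bavg_flat]

/-- At the flat background the nested mean is the iterated flat block mean `(bmean L)^[j]`. [folklore] -/
theorem bmeanIterW_one (L : ℕ) : ∀ (j : ℕ) (mu : Site d → Matrix n n ℂ),
    bmeanIterW L j (1 : Site d → Fin d → (Matrix n n ℂ)ˣ) mu = (bmean L)^[j] mu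
  | 0, mu => by simp
  | j + 1, mu => by
      rw [bmeanIterW_succ, cavg_one, bmeanW_one, bmeanIterW_one L j, Function.iterate_succ_apply]

/-- **THE SINGLE-SCALE MEAN IS THE FLAT MEAN OF THE COMB-DRESSED FIELD**: `bmeanW M W ξ z = bmean M (x ↦ Ad_{W(Γ_{M•z,x})} ξ(x)) z`
(`btree M W z x = W(Γ_{M•z,x})`). [folklore] -/
theorem bmeanW_eq_bmean_comb (M : ℕ) (W : Site d → Fin d → (Matrix n n ℂ)ˣ) (ξ : Site d → Matrix n n ℂ) (z : Site d) :
    bmeanW M W ξ z = bmean M (fun x => Ad (btree M W z x) (ξ x)) z := by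
  unfold bmeanW bmean btree
  refine Finset.sum_congr rfl fun r _ => ?_
  simp only [add_sub_cancel_left]

/-! ## §3 Box bookkeeping: the bonds read by tree words and straight segments, and the one-level estimates -/

/-- **THE BONDS OF A TREE WORD STAY IN ITS BOX**: for `v ≥ 0`, every bond `b` of `Γ_{x,x+v}` has both endpoints in `[x, x+v]`:
`x ≤ b₋` and `b₊ = b₋ + e_{b} ≤ x + v`. [cite: Balaban1985Averaging, p.24; Balaban1984PropagatorsI, (1.7) p.18] -/
theorem bondsOf_treeWord_box (v : Site d) (hv : 0 ≤ v) (x : Site d) (b : Site d × Fin d)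
    (hb : b ∈ bondsOf x (treeWord v)) : x ≤ b.1 ∧ b.1 + e b.2 ≤ x + v := by
  -- along the flat-map over the axes, the running point `p` satisfies `x ≤ p` and `p + Σ_{remaining} v_a e_a ≤ x + v`
  have key : ∀ (axes : List (Fin d)) (p : Site d), x ≤ p → p + (axes.map fun a => v a • e a).sum ≤ x + v →
      ∀ b : Site d × Fin d, b ∈ bondsOf p (axes.flatMap fun i => seg i (v i)) → x ≤ b.1 ∧ b.1 + e b.2 ≤ x + v := by
    intro axes
    induction axes with
    | nil => intro p _ _ b hb; simp at hb
    | cons i axes ih =>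
        intro p hxp hpv b hb
        rw [List.flatMap_cons, bondsOf_append, List.mem_append] at hb
        have hvi : v i = ((v i).toNat : ℤ) := (Int.toNat_of_nonneg (hv i)).symm
        have hrest : 0 ≤ (axes.map fun a => v a • e a).sum := by
          refine List.sum_nonneg ?_
          intro w hw
          obtain ⟨a, -, rfl⟩ := List.mem_map.mp hw
          intro κ
          simp only [Pi.smul_apply, e_apply, smul_eq_mul, Pi.zero_apply]
          split_ifs
          · simpa using hv a
          · simp
        rw [List.map_cons, List.sum_cons] at hpv
        rcases hb with hb | hb
        · rw [hvi] at hb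
          obtain ⟨j, hj, rfl⟩ := (mem_bondsOf_seg_iff p i _ b).mp hb
          refine ⟨?_, ?_⟩
          · intro κ
            have hx : x κ ≤ p κ := hxp κ
            have h01 : (0 : ℤ) ≤ (j : ℤ) * (if κ = i then 1 else 0) := by split_ifs <;> simp
            simp only [Pi.add_apply, Pi.smul_apply, e_apply, smul_eq_mul]
            linarith
          · intro κ
            have h1 : p κ + (v i * (if κ = i then 1 else 0) + (axes.map fun a => v a • e a).sum κ) ≤ x κ + v κ := by
              have := hpv κ
              simpa only [Pi.add_apply, Pi.smul_apply, e_apply, smul_eq_mul] using this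
            have h2 : (0 : ℤ) ≤ (axes.map fun a => v a • e a).sum κ := hrest κ
            simp only [Pi.add_apply, Pi.smul_apply, e_apply, smul_eq_mul]
            by_cases hκ : κ = i
            · subst hκ
              simp only [if_true, mul_one] at h1 ⊢
              have hjv : (j : ℤ) + 1 ≤ v κ := by omega
              linarith
            · simp only [if_neg hκ, mul_zero, add_zero] at h1 ⊢
              have hvi0 : 0 ≤ v κ := hv κ
              have hxp0 : x κ ≤ p κ := hxp κ
              linarith
        · have hxp' : x ≤ p + disp (seg i (v i)) := by
            rw [disp_seg]
            intro κ
            have hx : x κ ≤ p κ := hxp κ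
            have h01 : (0 : ℤ) ≤ v i * (if κ = i then 1 else 0) := by
              split_ifs
              · simpa using hv i
              · simp
            simp only [Pi.add_apply, Pi.smul_apply, e_apply, smul_eq_mul]
            linarith
          have hpv' : p + disp (seg i (v i)) + (axes.map fun a => v a • e a).sum ≤ x + v := by
            rw [disp_seg, add_assoc]; exact hpv
          exact ih _ hxp' hpv' b hb
  refine key _ x le_rfl (le_of_eq ?_) b hb
  congr 1
  rw [List.map_reverse, List.sum_reverse]
  conv_rhs => rw [← sum_zsmul_e v]
  rw [Fin.sum_univ_def]

/-- **TRANSPORT ALONG A TREE WORD IN A NEAR-IDENTITY BOX**: if every bond with both endpoints in `[lo, hi]` is within `b` of `1`,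
then for `lo ≤ p`, `p + v ≤ hi`, `v ≥ 0`: `‖W(Γ_{p,p+v}) − 1‖ ≤ |v|₁·b` (telescoping on `U(N)`). [folklore] -/
theorem norm_hol_treeWord_sub_one_le [Nonempty n] {W : Site d → Fin d → (Matrix n n ℂ)ˣ} (hWu : IsUnitaryCfg W)
    {lo hi : Site d} {b : ℝ} (hb : ∀ y ν, lo ≤ y → y + e ν ≤ hi → ‖((W y ν : (Matrix n n ℂ)ˣ) : Matrix n n ℂ) - 1‖ ≤ b)
    {p v : Site d} (hv : 0 ≤ v) (hlo : lo ≤ p) (hhi : p + v ≤ hi) :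
    ‖((hol W p (treeWord v) : (Matrix n n ℂ)ˣ) : Matrix n n ℂ) - 1‖ ≤ (l1 v : ℝ) * b := by
  have h := norm_hol_sub_one_le_of_bonds hWu p (treeWord v) fun c hc => by
    obtain ⟨h1, h2⟩ := bondsOf_treeWord_box v hv p c hc
    exact hb c.1 c.2 (hlo.trans h1) (h2.trans hhi)
  rwa [length_treeWord] at h

/-- **TRANSPORT ALONG A STRAIGHT SEGMENT IN A NEAR-IDENTITY BOX**: `lo ≤ p`, `p + k e_κ ≤ hi` ⇒ `‖W([p, p + k e_κ]) − 1‖ ≤ k·b`. [folklore] -/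
theorem norm_hol_seg_sub_one_le [Nonempty n] {W : Site d → Fin d → (Matrix n n ℂ)ˣ} (hWu : IsUnitaryCfg W)
    {lo hi : Site d} {b : ℝ} (hb : ∀ y ν, lo ≤ y → y + e ν ≤ hi → ‖((W y ν : (Matrix n n ℂ)ˣ) : Matrix n n ℂ) - 1‖ ≤ b)
    {p : Site d} {κ : Fin d} {k : ℕ} (hlo : lo ≤ p) (hhi : p + (k : ℤ) • e κ ≤ hi) :
    ‖((hol W p (seg κ (k : ℤ)) : (Matrix n n ℂ)ˣ) : Matrix n n ℂ) - 1‖ ≤ (k : ℝ) * b := by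
  have h := norm_hol_sub_one_le_of_bonds hWu p (seg κ (k : ℤ)) fun c hc => by
    obtain ⟨j, hj, rfl⟩ := (mem_bondsOf_seg_iff p κ k c).mp hc
    refine hb _ _ ?_ ?_
    · intro ι
      have hx : lo ι ≤ p ι := hlo ι
      have h01 : (0 : ℤ) ≤ (j : ℤ) * (if ι = κ then 1 else 0) := by split_ifs <;> simp
      simp only [Pi.add_apply, Pi.smul_apply, e_apply, smul_eq_mul]
      linarith
    · intro ι
      have h1 : p ι + (k : ℤ) * (if ι = κ then 1 else 0) ≤ hi ι := by
        have := hhi ι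
        simpa only [Pi.add_apply, Pi.smul_apply, e_apply, smul_eq_mul] using this
      simp only [Pi.add_apply, Pi.smul_apply, e_apply, smul_eq_mul]
      by_cases hι : ι = κ
      · simp only [hι, if_true, mul_one] at h1 ⊢
        have hjk : (j : ℤ) + 1 ≤ k := by omega
        linarith
      · simp only [if_neg hι, mul_zero, add_zero] at h1 ⊢
        exact h1
  rw [length_seg] at h
  simpa using h


/-- **THE COMB (AXIAL) GAUGE OF AN `M`-BLOCK IS A NEAR-IDENTITY BOX**: every bond with both endpoints in `[M•z, M•z + (M−1)𝟙]` of
`W₀ := W^{btree M W z}` is within `(d−1)(M−1)·a` of `1` in the small-field class (`NE3CombGauge.norm_comb_sub_one_le_single`).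
[cite: Balaban1985Averaging, pp.24–25] -/
theorem comb_nearOne [Nonempty n] {M : ℕ} {W : Site d → Fin d → (Matrix n n ℂ)ˣ} (hWu : IsUnitaryCfg W) {a : ℝ} (ha : 0 ≤ a)
    (hWa : SmallField W a) (z : Site d) :
    ∀ (y : Site d) (ν : Fin d), (M : ℤ) • z ≤ y → y + e ν ≤ (M : ℤ) • z + (fun _ => (M : ℤ) - 1) →
      ‖((gaugeAct (btree M W z) W y ν : (Matrix n n ℂ)ˣ) : Matrix n n ℂ) - 1‖ ≤ ((d : ℝ) - 1) * ((M : ℝ) - 1) * a := by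
  intro y ν hy hy'
  have hye : y ≤ y + e ν := by
    intro ι
    simp only [Pi.add_apply, e_apply, le_add_iff_nonneg_right]
    split_ifs <;> simp
  exact norm_comb_sub_one_le_single hWu hWa ha z hy (hye.trans hy') ν

/-- Jensen for the transported block mean: `‖bmeanW L W μ y‖ ≤ Σ_r L^{−d}‖μ(L•y + r)‖` (isometric transports). [folklore] -/
theorem norm_bmeanW_le_mean {L : ℕ} {W : Site d → Fin d → (Matrix n n ℂ)ˣ} (hWu : IsUnitaryCfg W) (mu : Site d → Matrix n n ℂ)
    (y : Site d) : ‖bmeanW L W mu y‖ ≤ ∑ r : Fin d → Fin L, ((L : ℝ) ^ d)⁻¹ * ‖mu ((L : ℤ) • y + boxVec L r)‖ := by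
  unfold bmeanW
  refine (norm_sum_le _ _).trans (Finset.sum_le_sum fun r _ => ?_)
  rw [norm_smul, Real.norm_eq_abs, abs_of_nonneg (by positivity), norm_Ad_of_unitary (hol_mem_of hWu _ _)]

/-- **ONE LEVEL — TRANSPORTED VERSUS FLAT BLOCK MEAN IN A NEAR-IDENTITY BOX**: if every bond with both endpoints in `[lo, hi]` is
within `b` of `1` and the `L`-block of `y` lies in the box, then
`‖bmeanW L W μ y − bmean L μ y‖ ≤ 2·d·L·b · Σ_r L^{−d}‖μ(L•y + r)‖` (tree words have `≤ d·L` bonds; `‖Ad_h X − X‖ ≤ 2‖h − 1‖‖X‖`).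
[folklore] -/
theorem norm_bmeanW_sub_bmean_le [Nonempty n] {L : ℕ} {W : Site d → Fin d → (Matrix n n ℂ)ˣ} (hWu : IsUnitaryCfg W)
    {lo hi : Site d} {b : ℝ} (hb0 : 0 ≤ b)
    (hb : ∀ y ν, lo ≤ y → y + e ν ≤ hi → ‖((W y ν : (Matrix n n ℂ)ˣ) : Matrix n n ℂ) - 1‖ ≤ b)
    (mu : Site d → Matrix n n ℂ) {y : Site d} (hlo : lo ≤ (L : ℤ) • y) (hhi : (L : ℤ) • y + (fun _ => (L : ℤ) - 1) ≤ hi) :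
    ‖bmeanW L W mu y - bmean L mu y‖ ≤ 2 * d * L * b * ∑ r : Fin d → Fin L, ((L : ℝ) ^ d)⁻¹ * ‖mu ((L : ℤ) • y + boxVec L r)‖ := by
  unfold bmeanW bmean
  rw [← Finset.sum_sub_distrib, Finset.mul_sum]
  refine (norm_sum_le _ _).trans (Finset.sum_le_sum fun r _ => ?_)
  have hv0 : (0 : Site d) ≤ boxVec L r := fun ι => (boxVec_bounds L r ι).1
  have hvhi : (L : ℤ) • y + boxVec L r ≤ hi := by
    refine le_trans ?_ hhi
    intro ι
    have := (boxVec_bounds L r ι).2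
    simp only [Pi.add_apply]
    omega
  have hhol := norm_hol_treeWord_sub_one_le hWu hb hv0 hlo hvhi
  have hl1 : (l1 (boxVec L r) : ℝ) * b ≤ (d : ℝ) * L * b := by
    have h := l1_boxVec_le L r
    exact mul_le_mul_of_nonneg_right (by exact_mod_cast h) hb0
  have hAd := norm_Ad_sub_le (hol_mem_of hWu ((L : ℤ) • y) (treeWord (boxVec L r))) (mu ((L : ℤ) • y + boxVec L r))
  rw [← smul_sub, norm_smul, Real.norm_eq_abs, abs_of_nonneg (by positivity)]
  have hX := norm_nonneg (mu ((L : ℤ) • y + boxVec L r))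
  have hLd : (0 : ℝ) ≤ ((L : ℝ) ^ d)⁻¹ := by positivity
  calc ((L : ℝ) ^ d)⁻¹ * ‖Ad (hol W ((L : ℤ) • y) (treeWord (boxVec L r))) (mu ((L : ℤ) • y + boxVec L r)) - mu ((L : ℤ) • y + boxVec L r)‖
      ≤ ((L : ℝ) ^ d)⁻¹ * (2 * ((d : ℝ) * L * b) * ‖mu ((L : ℤ) • y + boxVec L r)‖) := by
        refine mul_le_mul_of_nonneg_left (hAd.trans ?_) hLd
        nlinarith [hhol.trans hl1]
    _ = 2 * d * L * b * (((L : ℝ) ^ d)⁻¹ * ‖mu ((L : ℤ) • y + boxVec L r)‖) := by ring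

/-- **`‖V̄(c) − U(Γ_c)‖ ≤ 4·loopRad`**: the averaged bond against the straight transport, unframed (the tree's
`AveragingDeficitBlockDensity.norm_cavg_inv_bseg_sub_one_le` read through the unitary `V̄(c)`). [cite: Balaban1985Averaging, (42) p.23, p.25] -/
theorem norm_cavg_sub_bseg_le [Nonempty n] {L : ℕ} (hL : 1 ≤ L) {W : Site d → Fin d → (Matrix n n ℂ)ˣ} (hWu : IsUnitaryCfg W)
    {a : ℝ} (ha : 0 ≤ a) (h512 : 512 * (d + 1) * (d + 4) * (L : ℝ) ^ 2 * a ≤ 1) (hWa : SmallField W a) (y : Site d) (ν : Fin d) :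
    ‖((cavg L W y ν : (Matrix n n ℂ)ˣ) : Matrix n n ℂ) - bseg L W y ν‖ ≤ 4 * loopRad d L a := by
  have h := norm_cavg_inv_bseg_sub_one_le hL hWu ha h512 hWa y ν
  have hc := cavg_mem hL hWu ha h512 hWa y ν
  have e1 : ((cavg L W y ν : (Matrix n n ℂ)ˣ) : Matrix n n ℂ) - bseg L W y ν
      = -(((cavg L W y ν : (Matrix n n ℂ)ˣ) : Matrix n n ℂ) * ((((cavg L W y ν)⁻¹ * bseg L W y ν : (Matrix n n ℂ)ˣ) : Matrix n n ℂ) - 1)) := by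
    rw [Units.val_mul, mul_sub, mul_one, ← mul_assoc, Units.mul_inv, one_mul, neg_sub]
  rw [e1, norm_neg, CStarRing.norm_mem_unitary_mul _ (mem_unitaryUnits.mp hc)]
  exact h

/-- **ONE LEVEL — THE AVERAGED BACKGROUND STAYS NEAR `1` ON THE COARSE BOX**: in the standard small-field class, if every bond of
`W` with both endpoints in `[lo, hi]` is within `b` of `1` and the straight segment `[L•y, L•(y+e_ν)]` lies in the box, then
`‖(cavg L W)(y, ν) − 1‖ ≤ L·b + 4·loopRad(d,L,a)` (`‖U(Γ_c) − V̄(c)‖ ≤ 4·loopRad` + telescoping along `Γ_c`).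
[cite: Balaban1985Averaging, (42) p.23, p.25] -/
theorem norm_cavg_sub_one_le [Nonempty n] {L : ℕ} (hL : 1 ≤ L) {W : Site d → Fin d → (Matrix n n ℂ)ˣ} (hWu : IsUnitaryCfg W)
    {a : ℝ} (ha : 0 ≤ a) (h512 : 512 * (d + 1) * (d + 4) * (L : ℝ) ^ 2 * a ≤ 1) (hWa : SmallField W a)
    {lo hi : Site d} {b : ℝ} (hb : ∀ y ν, lo ≤ y → y + e ν ≤ hi → ‖((W y ν : (Matrix n n ℂ)ˣ) : Matrix n n ℂ) - 1‖ ≤ b)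
    {y : Site d} {ν : Fin d} (hlo : lo ≤ (L : ℤ) • y) (hhi : (L : ℤ) • (y + e ν) ≤ hi) :
    ‖((cavg L W y ν : (Matrix n n ℂ)ˣ) : Matrix n n ℂ) - 1‖ ≤ L * b + 4 * loopRad d L a := by
  have hseg : ‖((bseg L W y ν : (Matrix n n ℂ)ˣ) : Matrix n n ℂ) - 1‖ ≤ (L : ℝ) * b := by
    unfold bseg
    exact norm_hol_seg_sub_one_le hWu hb hlo (by rwa [smul_add] at hhi)
  have hcb := norm_cavg_sub_bseg_le hL hWu ha h512 hWa y ν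
  calc ‖((cavg L W y ν : (Matrix n n ℂ)ˣ) : Matrix n n ℂ) - 1‖
      = ‖(((cavg L W y ν : (Matrix n n ℂ)ˣ) : Matrix n n ℂ) - bseg L W y ν) + (((bseg L W y ν : (Matrix n n ℂ)ˣ) : Matrix n n ℂ) - 1)‖ := by
        rw [sub_add_sub_cancel]
    _ ≤ 4 * loopRad d L a + L * b := (norm_add_le _ _).trans (add_le_add hcb hseg)
    _ = L * b + 4 * loopRad d L a := by ring

end

end Summit.QuantumFields.BalabanUV.T4Continuum.NE3NestedBlockMeanCovariance
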